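import Summits.AtomisticToContinuum.FouriersLaw.Theses.JunctionLocality

/-!
# `JunctionLocality.Assembly` — proved

Item `stmt-AtomisticToContinuum-11754` (assembly, rank 1, route `JunctionLocality`, sub-problem
`FouriersLaw`):

`SuperadditiveFekete → SuperadditiveResistance → NonBallistic → ConductanceLowerBound →
PositiveConductance → NessUnique → FiniteResponseOfUnique → FouriersLaw`.

This is literally the type of the route file's sorry-free deciding theorem
`Summit.AtomisticToContinuum.FouriersLaw.Theses.JunctionLocality.closes` (same seven hypotheses,
same order): clause (i) of `FouriersLawFor` from the proved existence fact
`pinnedChain_exists_isSteadyState` (Cuneo–Eckmann–Hairer–Rey-Bellet 2018, Thm 2.13) plus weak-NESS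
uniqueness; clause (ii) along the canonical steady-state family, where `SuperadditiveFekete` fed with
the three cruxes and fixed-`N` positivity produces `κ_T > 0` with `D_N → κ_T`, and uniqueness
transfers the `δ`-limits to every steady-state family. Nothing beyond `closes` is used.
-/

namespace Summit.AtomisticToContinuum.FouriersLaw.Theorems.JunctionLocality

/-- **Assembly of route `JunctionLocality`** (item `stmt-AtomisticToContinuum-11754`):
`SuperadditiveFekete → SuperadditiveResistance → NonBallistic → ConductanceLowerBound →
PositiveConductance → NessUnique → FiniteResponseOfUnique → FouriersLaw`.
Proof: unfold `Assembly` and apply the route's sorry-free deciding theorem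
`Theses.JunctionLocality.closes`, whose type it is verbatim. -/
theorem assembly_proof :
    Summit.AtomisticToContinuum.FouriersLaw.Theses.JunctionLocality.Assembly := by
  unfold Summit.AtomisticToContinuum.FouriersLaw.Theses.JunctionLocality.Assembly
  exact Summit.AtomisticToContinuum.FouriersLaw.Theses.JunctionLocality.closes

end Summit.AtomisticToContinuum.FouriersLaw.Theorems.JunctionLocality
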